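import Summits.ValiantsHypothesis.ValiantsHypothesis.Theorems.ValuativeGCTValuativeFlipPaddingLift
import Summits.ValiantsHypothesis.ValiantsHypothesis.Theorems.ValuativeGCTValuativeFlipDetEventualMonotone
import Summits.ValiantsHypothesis.ValiantsHypothesis.Theorems.BorderApolarityFixedWitnessObstructionQPInterp
import Summits.ValiantsHypothesis.ValiantsHypothesis.Theorems.BorderApolarityFixedWitnessObstructionQPDeborder

/-!
# Effective padding monotonicity of the determinant's orbit-closure multiplicities
# (crux `ValuativeGCT.ValuativeFlip`, stmt-ValiantsHypothesis-12624; wall-breaker axis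
# "representation-stability transfer `m ↔ m + 1`", k16 gen 1, seat 3)

Write `K_m(λ*) = mult_{λ*} ℂ[Δ(det_m)]` (`orbitMultiplicity ℂ (detFormLex ℂ m) m (partitionWeightLex m λ)`)
and `λ♯(m+j) = λ + (jδ)` (`rowLift λ j`).  The transfer `K_m(λ*) ≤ K_{m+j}((λ♯)*)` along the padding is
the determinant half of BLMW 2011 Problem 6.10 / Kadish–Landsberg 2014 Question 1.5.  In the tree it was
known (i) for ALL forms at once in the Manivel range (`plethysmCoeff_le_orbitMultiplicity_rowLift`,
exponential `j`), (ii) EVENTUALLY in `j` with an ineffective threshold `j₀(m, δ, λ)`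
(`det_eventualMonotone`, generic rank of Δ_j-twisted evaluation matrices), and (iii) at every `j` MODULO
"derivative preimages" (`orbitMultiplicity_le_rowLift_of_derivPreimage`, k12): the Kadish–Landsberg/BIP
lift `L` evaluates as `(L F)(q') = F((∂_top^j q')|segment)`, so it proves the transfer as soon as every
orbit point `A · det_m` is `(∂_top^j q')|segment` for some `q' ∈ Δ(det_{m+j})`.  The natural candidates
`q' = X_top^j · ι(h̃)`, `h̃ = j!·X_top^{-j} I_top^j (A · det_m)` the inverse twist (a weighted AVERAGE of torus
translates of `A · det_m`), fail for general orbit closures, which are not closed under averages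
(`…PaddingLift.lean`, residual) — but `Δ(det)` IS, at polynomial cost in the size: weighted-homogeneous
components and sums of forms with affine determinantal expressions again have such expressions
(Vandermonde interpolation `stub_interp` and `hasDetRepr_sum_of_isHomogeneous` of the BorderApolarity
route, Valiant's universality made quantitative), and padded forms of determinantal complexity `≤ m + j`
lie in `Δ(det_{m+j})` (Mulmuley–Sohoni Prop. 4.4).  Hence:

* `exists_derivPreimage_of_hasDetRepr` — a form `h` of degree `m` on `Mat_m` with `HasDetRepr h s` is the
  segment restriction of `∂_top^j q'` for some `q' ∈ Δ(det_{m+j})` whenever `m + j ≥ (m+1)·2(s+1)^9 + 1`;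
* `det_derivPreimage` — the case `h = A · det_m` (`s = m`): threshold `m + j ≥ 2(m+1)^10 + 1`;
* `det_paddingMonotone_of_le`, `det_paddingMonotone` — **`K_n(μ*) ≤ K_{n+j}((μ♯(n+j))*)` for EVERY
  `μ ⊢ nδ` (`≤ n²` parts), every `δ`, and every `j ≥ 2(n+1)^10`** (resp. `n + j ≥ 2(n+1)^10 + 1`).

For the crux: by `valuativeFlip_iff_polyPadded` only positions `m ≥ n^k` matter (any fixed `k`); at all of
them with `k ≥ 11` the determinant multiplicity a witness `λ = μ♯(m-n)` must undercut dominates the INNER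
determinant multiplicity `K_n(μ*)` of its inner shape — effective, where `det_eventualMonotone` gave no
position at all.  The per-side analogue (padded permanents) stays open at every fixed `j`: `Δ(X^{j} per_n)`
is not known to absorb sums without growing the inner size.

Sources: Mulmuley–Sohoni, SIAM J. Comput. 31 (2001) Prop. 4.4; BLMW, SIAM J. Comput. 40 (2011) §6.4
Problem 6.10; Kadish–Landsberg, Commun. Algebra 42 (2014) Question 1.5; Ikenmeyer–Panova, Adv. Math. 319
(2017) Prop. 2.6(b), Lemma 2.7; Bürgisser–Ikenmeyer–Panova, J. AMS 32 (2019) Lemma 5.2–5.3, Thm. 5.4;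
Bürgisser 2004 (arXiv:cs/0212057) Lemma 5.5(3); Valiant 1979.
-/

set_option linter.dupNamespace false

namespace Summit.ValiantsHypothesis.ValiantsHypothesis.Theorems.ValuativeFlip

open scoped BigOperators
open MvPolynomial
open Literature.NumberTheory.DiophantineGeometry
open Literature.Computability.AlgebraicComplexity
open Literature.Computability.Complexity

noncomputable section

/-- **BIP Lemma 5.2 coefficientwise, for arbitrary polynomials**: the coefficient of `x^d` in
`∂_i^r (x_i^r · p)` is `(d_i + r)!/d_i!` times that of `p`. [Bürgisser–Ikenmeyer–Panova 2019 Lemma 5.2] -/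
theorem coeff_iterPderiv_X_pow_mul {σ : Type*} (i : σ) (r : ℕ) (p : MvPolynomial σ ℂ) (d : σ →₀ ℕ) :
    coeff d (iterPderiv i r (X i ^ r * p)) = (((d i + r).descFactorial r : ℕ) : ℂ) * coeff d p := by
  classical
  induction p using MvPolynomial.induction_on' with
  | monomial u a =>
    rw [iterPderiv_X_pow_mul_monomial, coeff_monomial, coeff_monomial]
    by_cases hu : u = d
    · subst hu
      rw [if_pos rfl, if_pos rfl, mul_comm]
    · rw [if_neg hu, if_neg hu, mul_zero]
  | add p q hp hq =>
    rw [mul_add, map_add, coeff_add, coeff_add, hp, hq, mul_add]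

/-- **The segment restriction of the `j`-th top derivative of a padded form is the twist `Δ_j`**:
`coeff_s ((∂_top^j (X_top^j · ι f))|segment) = (s_top + j)!/s_top! · coeff_s f` (BIP Lemma 5.2 transported
along the final-segment embedding, which maps `top ↦ top`). [Bürgisser–Ikenmeyer–Panova 2019 Lemma 5.2;
Ikenmeyer–Panova 2017 Prop. 2.6(b)] -/
theorem coeff_killCompl_iterPderiv_paddedForm {m : ℕ} [NeZero m] (j : ℕ) [NeZero (m + j)]
    (f : MvPolynomial (MatIdx m) ℂ) (s : MatIdx m →₀ ℕ) :
    coeff s (killCompl (segEmb_strictMono (Nat.le_add_right m j)).injective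
        (iterPderiv (topMatIdx (m + j)) j (paddedForm m j f))) =
      (((s (topMatIdx m) + j).descFactorial j : ℕ) : ℂ) * coeff s f := by
  classical
  have hι := (segEmb_strictMono (Nat.le_add_right m j)).injective
  rw [coeff_killCompl, paddedForm, coeff_iterPderiv_X_pow_mul, ← segEmb_topMatIdx (Nat.le_add_right m j),
    Finsupp.mapDomain_apply hι, coeff_rename_mapDomain _ hι]

/-- The weight `ε_i` (one on the variable `i`, zero elsewhere) of an exponent vector is its `i`-th
exponent. [folklore] -/
theorem weight_piSingle_one_apply {σ : Type*} [DecidableEq σ] (i : σ) (s : σ →₀ ℕ) :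
    Finsupp.weight (Pi.single i 1 : σ → ℕ) s = s i := by
  rw [Finsupp.weight_apply, Finsupp.sum]
  simp only [smul_eq_mul, Pi.single_apply, mul_ite, mul_one, mul_zero]
  rw [Finset.sum_ite_eq']
  split_ifs with h
  · rfl
  · exact (Finsupp.notMem_support_iff.mp h).symm

/-- Affine determinantal expressions are stable under scalars (size `≥ 1`): scale the first row.
[folklore] -/
theorem hasDetRepr_smul {σ : Type*} {f : MvPolynomial σ ℂ} {s : ℕ} (hs : 1 ≤ s) (c : ℂ)
    (h : HasDetRepr f s) : HasDetRepr (c • f) s := by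
  obtain ⟨M, hM, hdet⟩ := h
  haveI : NeZero s := ⟨by omega⟩
  refine ⟨M.updateRow 0 ((C c : MvPolynomial σ ℂ) • M 0), fun i k => ?_, ?_⟩
  · rw [Matrix.updateRow_apply]
    split_ifs with hi
    · rw [Pi.smul_apply, smul_eq_mul]
      refine (totalDegree_mul _ _).trans ?_
      rw [totalDegree_C, zero_add]
      exact hM 0 k
    · exact hM i k
  · rw [Matrix.det_updateRow_smul, Matrix.updateRow_eq_self, hdet, smul_eq_C_mul]

/-- **Derivative preimages of determinantal forms inside `Δ(det_{m+j})`** (the hypothesis of the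
padding lift `orbitMultiplicity_le_rowLift_of_derivPreimage`, discharged for the determinant).
Let `h` be a form of degree `m` in the `m²` lexicographic matrix variables with an affine determinantal
expression of size `s`.  If `m + j ≥ (m+1) · 2(s+1)^9 + 1` then there is a point `q'` of
`Δ(det_{m+j})` whose `j`-th derivative in the top variable, restricted to the final segment, is EXACTLY
`h` (no twist): `q' = X_top^j · ι(h̃)` with `h̃ = Σ_k (k!j!/(k+j)!) · h_k` the inverse twist of the
decomposition `h = Σ_k h_k` by the degree in the top variable (`h̃ = j! · X_top^{-j} I_top^j h`, the `j`-fold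
antiderivative); each `h_k` is a weighted-homogeneous component of `h`, hence a linear combination of
`m + 1` torus substitutes of `h` (Vandermonde interpolation, `stub_interp`), so `h̃` is a sum of `m + 1`
forms with determinantal expressions of size `s`, and sums of determinants cost
`(m+1) · 2(s+1)^9 + 1` (`hasDetRepr_sum_of_isHomogeneous`); padded forms with a determinantal expression
of size `m + j` lie in `Δ(det_{m+j})` (Mulmuley–Sohoni Prop. 4.4, `paddedForm_mem_orbitClosure_detFormLex`).
[Mulmuley–Sohoni 2001 Prop. 4.4; Bürgisser 2004 Lemma 5.5(3) (interpolation); Valiant 1979 (sums of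
determinants); Bürgisser–Ikenmeyer–Panova 2019 Lemma 5.2; new] -/
theorem exists_derivPreimage_of_hasDetRepr {m : ℕ} [NeZero m] (j : ℕ) [NeZero (m + j)]
    {h : MvPolynomial (MatIdx m) ℂ} (hh : h.IsHomogeneous m) {s : ℕ} (hs : 1 ≤ s)
    (hdet : HasDetRepr h s) (hj : (m + 1) * (2 * (s + 1) ^ 9) + 1 ≤ m + j) :
    ∃ q' ∈ orbitClosure (detFormLex ℂ (m + j)),
      killCompl (segEmb_strictMono (Nat.le_add_right m j)).injective
        (iterPderiv (topMatIdx (m + j)) j q') = h := by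
  classical
  -- the weight singling out the top variable: `weight w d = d_top`
  set w : MatIdx m → ℕ := Pi.single (topMatIdx m) 1 with hw
  have hwt : ∀ d : MatIdx m →₀ ℕ, Finsupp.weight w d = d (topMatIdx m) :=
    fun d => weight_piSingle_one_apply (topMatIdx m) d
  -- coefficients of `h` beyond top-degree `m` vanish
  have hvan : ∀ d : MatIdx m →₀ ℕ, m < d (topMatIdx m) → coeff d h = 0 := by
    intro d hd
    refine hh.coeff_eq_zero (ne_of_gt ?_)
    exact lt_of_lt_of_le hd (Finsupp.le_degree (topMatIdx m) d)
  -- the inverse twist constants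
  set c : ℕ → ℂ := fun k => ((((k + j).descFactorial j : ℕ) : ℂ))⁻¹ with hc
  have hcne : ∀ k, (((k + j).descFactorial j : ℕ) : ℂ) ≠ 0 := fun k =>
    Nat.cast_ne_zero.2 (descFactorial_add_pos k j).ne'
  -- the untwisted form `h̃`
  set f : MvPolynomial (MatIdx m) ℂ :=
    ∑ k ∈ Finset.range (m + 1), c k • weightedHomogeneousComponent w k h with hf
  -- its coefficients
  have hcoeff : ∀ d : MatIdx m →₀ ℕ, coeff d f = c (d (topMatIdx m)) * coeff d h := by
    intro d
    rw [hf, coeff_sum]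
    simp only [coeff_smul, coeff_weightedHomogeneousComponent, smul_eq_mul, mul_ite, mul_zero, hwt]
    rw [Finset.sum_ite_eq]
    split_ifs with hk
    · rfl
    · rw [Finset.mem_range, not_lt] at hk
      rw [hvan d (by omega), mul_zero]
  -- `h̃` is a form of degree `m`
  have hfhom : f.IsHomogeneous m := by
    intro d hd
    rw [hcoeff] at hd
    exact hh (right_ne_zero_of_mul hd)
  -- `h̃` has an affine determinantal expression of size `(m+1) · 2(s+1)^9 + 1`
  have hfdet : HasDetRepr f ((m + 1) * (2 * (s + 1) ^ 9) + 1) := by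
    -- weights on the support of `h` are at most `m`
    have hsupp : ∀ d ∈ h.support, Finsupp.weight w d ≤ m := by
      intro d hd
      rw [hwt]
      by_contra hlt
      exact (MvPolynomial.mem_support_iff.mp hd) (hvan d (by omega))
    -- interpolation of each top-degree component by torus substitutes
    choose γ hγ using fun k : ℕ =>
      Summit.ValiantsHypothesis.ValiantsHypothesis.Theorems.BorderApolarityFixedWitnessObstructionQP.stub_interp
        (MatIdx m) w m k h hsupp
    -- `h̃` as a combination of the `m + 1` torus substitutes
    set D : Fin (m + 1) → MvPolynomial (MatIdx m) ℂ := fun t =>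
      linSubst (MatIdx m) ℂ (Matrix.diagonal fun i => ((((t : ℕ) : ℂ)) + 1) ^ (w i)) h with hD
    have hfD : f = ∑ t : Fin (m + 1), (∑ k ∈ Finset.range (m + 1), c k * γ k t) • D t := by
      rw [hf]
      simp_rw [hγ, Finset.smul_sum, smul_smul, Finset.sum_smul]
      rw [Finset.sum_comm]
    have hsum :=
      Summit.ValiantsHypothesis.ValiantsHypothesis.Theorems.BorderApolarityFixedWitnessObstructionQP.hasDetRepr_sum_of_isHomogeneous
        (Finset.univ : Finset (Fin (m + 1))) (fun t => (∑ k ∈ Finset.range (m + 1), c k * γ k t) • D t) m s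
        (fun t _ => by
          rw [smul_eq_C_mul]
          exact (linSubst_isHomogeneous _ hh).C_mul _)
        (fun t _ => hasDetRepr_smul hs _ (hasDetRepr_linSubst _ hdet))
    rw [Finset.card_univ, Fintype.card_fin] at hsum
    rw [hfD]
    exact hsum
  -- hence of size `m + j`, so the padded form lies in `Δ(det_{m+j})`
  have hpad : paddedForm m j f ∈ orbitClosure (detFormLex ℂ (m + j)) :=
    paddedForm_mem_orbitClosure_detFormLex j hfhom (HasDetRepr.mono_holds hfdet hj)
  refine ⟨paddedForm m j f, hpad, ?_⟩
  -- and its `j`-th top derivative restricts to `Δ_j h̃ = h`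
  refine MvPolynomial.ext _ _ fun d => ?_
  rw [coeff_killCompl_iterPderiv_paddedForm, hcoeff, hc]
  simp only
  rw [← mul_assoc, mul_inv_cancel₀ (hcne _), one_mul]

/-- **Derivative preimages of the determinant orbit** — every translate `A · det_m` (`A ∈ Mat_{m²}`,
invertible or not) is the segment restriction of the `j`-th top derivative of a point of `Δ(det_{m+j})`,
as soon as `m + j ≥ 2 (m+1)^10 + 1`. [this file; Mulmuley–Sohoni 2001 Prop. 4.4] -/
theorem det_derivPreimage (m j : ℕ) [NeZero m] [NeZero (m + j)] (hj : 2 * (m + 1) ^ 10 + 1 ≤ m + j)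
    (A : Matrix (MatIdx m) (MatIdx m) ℂ) :
    ∃ q' ∈ orbitClosure (detFormLex ℂ (m + j)),
      killCompl (segEmb_strictMono (Nat.le_add_right m j)).injective
        (iterPderiv (topMatIdx (m + j)) j q') = linSubst (MatIdx m) ℂ A (detFormLex ℂ m) := by
  have hm : 1 ≤ m := Nat.one_le_iff_ne_zero.mpr (NeZero.ne m)
  refine exists_derivPreimage_of_hasDetRepr j (linSubst_isHomogeneous A (detFormLex_isHomogeneous ℂ m)) hm
    (hasDetRepr_linSubst A (hasDetRepr_detFormLex m)) ?_
  have : (m + 1) * (2 * (m + 1) ^ 9) + 1 = 2 * (m + 1) ^ 10 + 1 := by ring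
  omega

/-- **Effective padding monotonicity of the determinant's orbit-closure multiplicities** (the
determinant half of BLMW 2011 Problem 6.10 / Kadish–Landsberg 2014 Question 1.5 at EVERY padding beyond an
explicit polynomial threshold, uniformly in the degree `δ` and the shape).  For `μ ⊢ n·δ` with at most `n²`
parts and every `j` with `n + j ≥ 2 (n+1)^10 + 1`:
`K_n(μ*) ≤ K_{n+j}((μ♯(n+j))*)`, `K_m(λ*) = mult_{λ*} ℂ[Δ(det_m)]`.
Proof: the padding lift modulo derivative preimages (`orbitMultiplicity_le_rowLift_of_derivPreimage`, k12)
and `det_derivPreimage`.  Compare `det_eventualMonotone` (threshold `j₀(n, δ, μ)` ineffective, by generic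
rank of twisted evaluation matrices). [BLMW 2011 Problem 6.10; Kadish–Landsberg 2014 Question 1.5;
Ikenmeyer–Panova 2017 Prop. 2.6(b); new] -/
theorem det_paddingMonotone_of_le (n δ : ℕ) [NeZero n] (μ : Nat.Partition (n * δ))
    (hμ : μ.parts.card ≤ n * n) (j : ℕ) [NeZero (n + j)] (hj : 2 * (n + 1) ^ 10 + 1 ≤ n + j) :
    orbitMultiplicity ℂ (detFormLex ℂ n) n (partitionWeightLex n μ) ≤
      orbitMultiplicity ℂ (detFormLex ℂ (n + j)) (n + j) (partitionWeightLex (n + j) (rowLift μ j)) := by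
  refine orbitMultiplicity_le_rowLift_of_derivPreimage j (detFormLex_isHomogeneous ℂ (n + j))
    (fun h => Matrix.det_mvPolynomialX_ne_zero (m := Fin (n + j)) (R := ℂ)
      (rename_injective _ toLex.injective (h.trans (map_zero _).symm))) μ hμ fun g => ?_
  rw [linSubstRep_apply]
  exact det_derivPreimage n j hj (g : Matrix (MatIdx n) (MatIdx n) ℂ)

/-- **Effective padding monotonicity, padding form**: `K_n(μ*) ≤ K_{n+j}((μ♯)*)` for every
`j ≥ 2 (n+1)^10`. [this file] -/
theorem det_paddingMonotone (n δ : ℕ) [NeZero n] (μ : Nat.Partition (n * δ))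
    (hμ : μ.parts.card ≤ n * n) (j : ℕ) [NeZero (n + j)] (hj : 2 * (n + 1) ^ 10 ≤ j) :
    orbitMultiplicity ℂ (detFormLex ℂ n) n (partitionWeightLex n μ) ≤
      orbitMultiplicity ℂ (detFormLex ℂ (n + j)) (n + j) (partitionWeightLex (n + j) (rowLift μ j)) :=
  det_paddingMonotone_of_le n δ μ hμ j (by have := NeZero.ne n; omega)

end

end Summit.ValiantsHypothesis.ValiantsHypothesis.Theorems.ValuativeFlip
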